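import Literature.NumberTheory.Automorphic.NewformAdelisationDescentHolomorphy
import Literature.NumberTheory.Automorphic.AutomorphicRepsGLSatakeFlathProofs
import Literature.NumberTheory.Automorphic.ArchimedeanLieBracket
import Mathlib.LinearAlgebra.Eigenspace.Triangularizable
import HarnessLib

/-!
# `SO(2)`-weights, Maass raising and lowering operators, and weight-one vectors killed by the
lowering operator (Gelbart 1997, Prop. 2.5 with Remarks 2.5.2, 2.5.5; Bump 1997, §2.1–2.2)

Topic `NumberTheory/Automorphic`; the archimedean (`(𝔤𝔩₂, O(2))`-module) step of the dictionary
`π ↦ f_π` of Gelbart 1997, Prop. 2.5 in the direction "automorphic representation of weight one ↦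
weight-one cusp form" (used for Prop. 4.2, the weight-one dictionary for `π(σ)`, `σ` odd): from the
two invariants of `π_∞ = π(1, sgn)` that the tree can read — infinitesimal character of
Harish-Chandra parameter `{0, 0}`, i.e. the Casimir operator `Ω = ½h² + ef + fe` of `𝔰𝔩₂` acts by
`-1/2`, and the sign `π_∞(-1) = -1` (cf. `AutomorphicRepData.IsOfWeightOne` of
`StrongArtinGL2WeightOneDictionary`) — to a **vector of `SO(2)`-weight one killed by the lowering
operator `X = (1 -i; -i -1)`** (Gelbart 1997, Remark 2.5.5: "`X · φ_k = ((s₁ - s₂ + 1)/2 - k/2) φ_{k-2}`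
… we must have `s₁ = s₂ = 0`, i.e. `π_∞ = π(1, sgn)`", read backwards), which is the input
(iii)–(v) of the descent `φ ↦ f_φ` (`NewformAdelisationDescentHolomorphy.adelicDescentCuspForm`).

Everything is formulated for functions on an arbitrary group `G` receiving a homomorphism
`ι : GL₂(ℝ) → G` (in the application `G = GL₂(𝔸_ℚ)`, `ι = (g ↦ (g, 1))`), with the tree's right
translations `archTranslate ι` and Lie derivatives `lieDeriv ι` (`ArchimedeanCalculus`), and
everything is proved; there are no named facts.

* Rotations and reflection: `GL2Real.rotK θ = k_θ = (cos θ, sin θ; -sin θ, cos θ) = exp(θW)`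
  (`rotK_eq_expMem`, from `expGL_smul_rotGen`), `k_{θ+θ'} = k_θ k_θ'`, `k_{2π} = 1`, `k_π = -1`;
  `GL2Real.epsK = ε = diag(1, -1)`, `ε² = 1`, `ε k_θ ε = k_{-θ}`.
* `GL2Real.IsWeightVec ι m φ` — `φ(g k_θ) = e^{imθ} φ(g)` (Bump 1997, §2.1); linearity;
  `IsWeightVec.lieDeriv_rotGen` — `W φ = im φ` (Bump (2.33), `H = -iW` acts by `m`);
  `IsWeightVec.archTranslate_epsK` — `r(ε)` negates the weight; `IsWeightVec.odd` — if `k_π = -1`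
  acts by `-1` on `φ ≠ 0` then `m` is odd.
* `GL2Real.lieDeriv_rotGen_mem_of_finiteDimensional`, `exists_isWeightVec_of_lieDeriv_rotGen_eq_smul`,
  `exists_isWeightVec_mem_of_finiteDimensional` — **a non-zero finite-dimensional rotation-stable
  space of archimedean-smooth functions contains a non-zero weight vector**: it is stable under `W`
  (difference quotients and closedness of finite-dimensional subspaces for pointwise convergence),
  `W` has an eigenvector on it, and an eigenfunction `Wφ = cφ` satisfies `φ(g k_θ) = e^{cθ}φ(g)`
  (`(e^{-cθ} φ(g k_θ))' = 0`) with `e^{2πc} = 1`, i.e. `c = im`. This is the `SO(2)`-type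
  decomposition of a `K`-finite vector (Borel–Jacquet 1979, §1.3) in the weak form needed.
* `GL2Real.lowerFun ι`, `raiseFun ι`, `casimirFun ι` — `X = h - i(e + f)`, `X̄ = h + i(e + f)`
  (`h = E₁₁ - E₂₂`, `e = E₁₂`, `f = E₂₁`; twice Bump's `L`, `R`, (2.23)) and `Ω = ½h² + ef + fe` as
  (iterated, complexified) Lie derivatives; `lowerFun_incl_apply` — on `GL₂(ℝ)` this is
  `GL2Real.lowering`; `Ad_rotK_hMat`, `Ad_rotK_aMat` (`Ad(k_θ)` rotates the plane `⟨h, e+f⟩` by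
  `2θ`), `Ad_epsK_*`; `IsWeightVec.weight_lowerFun/weight_raiseFun` — **`X` lowers and `X̄` raises
  the weight by `2`** (`r(k)(Yφ) = (Ad(k)Y)(r(k)φ)`, `archTranslate_lieDeriv`);
  `archTranslate_epsK_raiseFun` — `r(ε) X̄ = X r(ε)`.
* `GL2Real.raiseFun_lowerFun` — **`X̄ (X φ) = 2Ωφ + W(Wφ) - 2i Wφ`** on archimedean-smooth `φ`
  (the identity `4RL = -4Δ - H² + 2H`, `-4Δ = H² + 2RL + 2LR = 2Ω` of `U(𝔤𝔩₂)_ℂ`, Bump 1997,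
  §2.2, from the bracket relations `[h, e] = 2e`, `[h, f] = -2f` through `lieDeriv_bracket_of_top`);
  `raiseFun_lowerFun_of_isWeightVec` — on a weight-`m` vector with `Ωφ = cφ`,
  `X̄ X φ = (2c - m² + 2m) φ`, `= -(m-1)² φ` for `c = -1/2` (Bump 1997, Exercise 2.1.7 (b)).
* `GL2Real.exists_isWeightVec_one_lowerFun_eq_zero`, `…_of_finite` — **the extraction**: in a
  space `W₁` of archimedean-smooth functions stable under the Lie derivatives and `r(ε)` on which
  `Ω = -1/2`, a non-zero vector of odd weight — in particular any non-zero `SO(2)`-finite vector on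
  which `k_π = -1` acts by `-1` — produces `ψ ∈ W₁`, `ψ ≠ 0`, of weight `1` with `X ψ = 0`
  (lower `v` of weight `2j+1 > 0` `j` times, each step non-zero since `X̄X = -(m-1)² ≠ 0`; at weight
  one either `Xu = 0` or `r(ε)(Xu)` works).
* Restriction along a homomorphism `j : GL₂(ℝ) → G` (`GL2Real.inclOf j`): `lowerFun_inclOf_apply`,
  `lowering_eq_zero_of_lowerFun_eq_zero`, `isArchSmooth_incl_of_inclOf`,
  `apply_mul_realScalarGL_of_lieDeriv_one` (`Zψ = 0` integrates to invariance under `ℝ_{>0}`),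
  `hasArchWeight_one_of_isWeightVec` — a weight-one `ψ` killed by `Z` gives, for every pull-back
  `F = ψ(a · j(·))` to `GL₂(ℝ)`, Gelbart's conditions (iii)–(iv) with `k = 1` (`HasArchWeight 1 F`)
  and, if `Xψ = 0`, condition (v) (`GL2Real.lowering F = 0`): exactly the archimedean hypotheses of
  `adelicDescentCuspForm N 1`.

## References

* S. Gelbart, *Three lectures on the modularity of `ρ̄_{E,3}` and the Langlands reciprocity
  conjecture* (1997), Prop. 2.5, Remark 2.5.2, sketch of proof (2.5.4), Remark 2.5.5, and the proof
  of Prop. 4.2 [Gelbart1997].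
* D. Bump, *Automorphic Forms and Representations* (1997), §2.1 (weights, Maass operators,
  Exercise 2.1.7), §2.2 ((2.23)–(2.24), Prop. 2.2.5, (2.31)–(2.36)) [Bump1997].
* A. Borel, H. Jacquet, *Automorphic forms and automorphic representations*, Proc. Sympos. Pure
  Math. 33 (1979), Part 1, §1.3, §1.5 [BorelJacquetCorvallis1979].
-/

noncomputable section

open scoped MatrixGroups Matrix ContDiff Topology
open Filter

namespace Literature.NumberTheory.Automorphic

-- Mathlib idiom (Mathlib/Algebra/Lie/OfAssociative.lean); needed to mention Lie subalgebras of matrix algebras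
attribute [local instance 100] LieRing.ofAssociativeRing

namespace GL2Real

/-! ### The rotations `k_θ = exp(θW)` and the reflection `ε = diag(1, -1)` in `GL₂(ℝ)` -/

/-- The matrix of `r(θ)`. [folklore] -/
theorem coe_rotGL (θ : ℝ) :
    ((rotGL θ : GL (Fin 2) ℝ) : Matrix (Fin 2) (Fin 2) ℝ) = !![Real.cos θ, -Real.sin θ; Real.sin θ, Real.cos θ] :=
  rfl

/-- `r(θ) r(θ') = r(θ + θ')`. [folklore] -/
theorem rotGL_mul_rotGL (θ θ' : ℝ) : rotGL θ * rotGL θ' = rotGL (θ + θ') := by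
  refine Units.ext ?_
  rw [Units.val_mul]
  ext i j
  fin_cases i <;> fin_cases j <;>
    simp [Matrix.mul_apply, Fin.sum_univ_two, rotGL_apply_zero_zero, rotGL_apply_zero_one,
      rotGL_apply_one_zero, rotGL_apply_one_one, Real.cos_add, Real.sin_add] <;> ring

/-- `r(0) = 1`. [folklore] -/
theorem rotGL_zero : rotGL 0 = 1 := by
  refine Units.ext ?_
  ext i j
  fin_cases i <;> fin_cases j <;>
    simp [rotGL_apply_zero_zero, rotGL_apply_zero_one, rotGL_apply_one_zero, rotGL_apply_one_one]

/-- `r(2π) = 1`. [folklore] -/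
theorem rotGL_two_pi : rotGL (2 * Real.pi) = 1 := by
  refine Units.ext ?_
  ext i j
  fin_cases i <;> fin_cases j <;>
    simp [rotGL_apply_zero_zero, rotGL_apply_zero_one, rotGL_apply_one_zero, rotGL_apply_one_one]

/-- `r(π) = -1`. [folklore] -/
theorem rotGL_pi : rotGL Real.pi = -1 := by
  refine Units.ext ?_
  ext i j
  fin_cases i <;> fin_cases j <;>
    simp [rotGL_apply_zero_zero, rotGL_apply_zero_one, rotGL_apply_one_zero, rotGL_apply_one_one]

/-- The rotation `k_θ = (cos θ, sin θ; -sin θ, cos θ) = exp(θW) = r(-θ)` as an element of (the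
carrier of) the linear real group `GL₂(ℝ)` (Bump 1997, (2.36): `exp(tW) = k_t`). [cite: Bump1997, (2.36)] -/
def rotK (θ : ℝ) : (RealMatrixGroup.gl ℝ (Fin 2)).carrier :=
  ⟨rotGL (-θ), Subgroup.mem_top _⟩

/-- `k_θ` is `r(-θ)` in `GL₂(ℝ)`. [folklore] -/
@[simp] theorem coe_rotK (θ : ℝ) : ((rotK θ : (RealMatrixGroup.gl ℝ (Fin 2)).carrier) : GL (Fin 2) ℝ) = rotGL (-θ) :=
  rfl

/-- `k_θ = exp(θW)`. [cite: Bump1997, (2.36)] -/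
theorem rotK_eq_expMem (θ : ℝ) : rotK θ = (RealMatrixGroup.gl ℝ (Fin 2)).expMem (θ • toLie rotGen) := by
  refine Subtype.ext ?_
  change rotGL (-θ) = expGL (θ • rotGen)
  rw [expGL_smul_rotGen]

/-- `k_θ k_θ' = k_{θ + θ'}`. [folklore] -/
theorem rotK_add (θ θ' : ℝ) : rotK (θ + θ') = rotK θ * rotK θ' := by
  refine Subtype.ext ?_
  change rotGL (-(θ + θ')) = rotGL (-θ) * rotGL (-θ')
  rw [rotGL_mul_rotGL, neg_add]

/-- `k_0 = 1`. [folklore] -/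
@[simp] theorem rotK_zero : rotK 0 = 1 := by
  refine Subtype.ext ?_
  change rotGL (-0) = 1
  rw [neg_zero, rotGL_zero]

/-- `exp 0 = 1` in the linear real group `GL₂(ℝ)`. [folklore] -/
@[simp] theorem expMem_zero_gl2 : (RealMatrixGroup.gl ℝ (Fin 2)).expMem 0 = 1 :=
  Subtype.ext (by change expGL (0 : Matrix (Fin 2) (Fin 2) ℝ) = 1; exact expGL_zero)

/-- `k_{2π} = 1`. [folklore] -/
theorem rotK_two_pi : rotK (2 * Real.pi) = 1 := by
  refine Subtype.ext ?_
  change rotGL (-(2 * Real.pi)) = 1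
  have h : rotGL (-(2 * Real.pi)) * rotGL (2 * Real.pi) = 1 := by
    rw [rotGL_mul_rotGL, neg_add_cancel, rotGL_zero]
  rw [rotGL_two_pi, mul_one] at h
  exact h

/-- `k_π = -1`. [folklore] -/
theorem coe_rotK_pi : ((rotK Real.pi : (RealMatrixGroup.gl ℝ (Fin 2)).carrier) : GL (Fin 2) ℝ) = -1 := by
  change rotGL (-Real.pi) = -1
  have h : rotGL (-Real.pi) * rotGL Real.pi = 1 := by
    rw [rotGL_mul_rotGL, neg_add_cancel, rotGL_zero]
  rw [rotGL_pi, mul_neg_one, neg_eq_iff_eq_neg] at h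
  exact h

/-- The reflection `ε = diag(1, -1) ∈ O(2) ∖ SO(2)`, which conjugates `k_θ` to `k_{-θ}` and
exchanges the raising and lowering operators. [folklore] -/
def epsGL : GL (Fin 2) ℝ :=
  Matrix.GeneralLinearGroup.mkOfDetNeZero !![1, 0; 0, -1] (by rw [Matrix.det_fin_two_of]; norm_num)

/-- The matrix of `ε`. [folklore] -/
theorem coe_epsGL : ((epsGL : GL (Fin 2) ℝ) : Matrix (Fin 2) (Fin 2) ℝ) = !![1, 0; 0, -1] := rfl

/-- `ε² = 1`. [folklore] -/
theorem epsGL_mul_epsGL : epsGL * epsGL = 1 := by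
  refine Units.ext ?_
  rw [Units.val_mul, coe_epsGL]
  ext i j
  fin_cases i <;> fin_cases j <;> simp [Matrix.mul_apply, Fin.sum_univ_two]

/-- `ε r(θ) ε = r(-θ)`. [folklore] -/
theorem epsGL_mul_rotGL_mul_epsGL (θ : ℝ) : epsGL * rotGL θ * epsGL = rotGL (-θ) := by
  refine Units.ext ?_
  simp only [Units.val_mul, coe_epsGL, coe_rotGL, Matrix.mul_fin_two, Real.cos_neg, Real.sin_neg]
  ext i j
  fin_cases i <;> fin_cases j <;> simp

/-- `ε` as an element of (the carrier of) the linear real group `GL₂(ℝ)`. [folklore] -/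
def epsK : (RealMatrixGroup.gl ℝ (Fin 2)).carrier :=
  ⟨epsGL, Subgroup.mem_top _⟩

/-- `ε` is `epsGL` in `GL₂(ℝ)`. [folklore] -/
@[simp] theorem coe_epsK : ((epsK : (RealMatrixGroup.gl ℝ (Fin 2)).carrier) : GL (Fin 2) ℝ) = epsGL := rfl

/-- `ε² = 1`. [folklore] -/
theorem epsK_mul_epsK : epsK * epsK = 1 :=
  Subtype.ext epsGL_mul_epsGL

/-- `ε k_θ ε = k_{-θ}`. [folklore] -/
theorem epsK_mul_rotK_mul_epsK (θ : ℝ) : epsK * rotK θ * epsK = rotK (-θ) := by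
  refine Subtype.ext ?_
  change epsGL * rotGL (-θ) * epsGL = rotGL (-(-θ))
  rw [epsGL_mul_rotGL_mul_epsGL]


/-! ### `SO(2)`-weights of functions -/

section Weights

variable {G : Type*} [Group G] (ι : (RealMatrixGroup.gl ℝ (Fin 2)).carrier →* G)

/-- `φ : G → ℂ` **has `SO(2)`-weight `m`** (with respect to `ι : GL₂(ℝ) → G`): `φ(g k_θ) = e^{imθ} φ(g)`
for all `θ`, `k_θ = (cos θ, sin θ; -sin θ, cos θ)` (Bump 1997, §2.1, before Prop. 2.1.2:
`f(g κ_θ) = e^{ikθ} f(g)`, "`C^∞(Γ\G, χ, k)`"; Gelbart 1997, (2.5.4) (iii) with `r(θ) = k_{-θ}`).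
A predicate with explicit arguments, not a named fact. [cite: Bump1997, §2.1] [cite: Gelbart1997, (2.5.4) (iii)] -/
def IsWeightVec (m : ℤ) (φ : G → ℂ) : Prop :=
  ∀ (θ : ℝ) (g : G), φ (g * ι (rotK θ)) = Complex.exp (m * θ * Complex.I) * φ g

variable {ι}

namespace IsWeightVec

variable {m : ℤ} {φ ψ : G → ℂ}

/-- The zero function has every weight. [folklore] -/
theorem zero (m : ℤ) : IsWeightVec ι m (0 : G → ℂ) := fun θ g => by simp

/-- Weight-`m` functions form a subspace: sums. [folklore] -/
theorem add (hφ : IsWeightVec ι m φ) (hψ : IsWeightVec ι m ψ) : IsWeightVec ι m (φ + ψ) := fun θ g => by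
  simp only [Pi.add_apply, hφ θ g, hψ θ g, mul_add]

/-- Weight-`m` functions form a subspace: scalar multiples. [folklore] -/
theorem smul (c : ℂ) (hφ : IsWeightVec ι m φ) : IsWeightVec ι m (c • φ) := fun θ g => by
  simp only [Pi.smul_apply, smul_eq_mul, hφ θ g]; ring

/-- Weight-`m` functions form a subspace: negatives. [folklore] -/
theorem neg (hφ : IsWeightVec ι m φ) : IsWeightVec ι m (-φ) := fun θ g => by
  simp only [Pi.neg_apply, hφ θ g, mul_neg]

/-- Weight-`m` functions form a subspace: differences. [folklore] -/
theorem sub (hφ : IsWeightVec ι m φ) (hψ : IsWeightVec ι m ψ) : IsWeightVec ι m (φ - ψ) := fun θ g => by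
  simp only [Pi.sub_apply, hφ θ g, hψ θ g, mul_sub]

/-- Right translation by `k_θ` multiplies a weight-`m` function by `e^{imθ}`. [cite: Bump1997, §2.1] -/
theorem archTranslate_rotK (hφ : IsWeightVec ι m φ) (θ : ℝ) :
    archTranslate ι (rotK θ) φ = Complex.exp (m * θ * Complex.I) • φ := by
  funext g
  rw [archTranslate_apply, hφ θ g, Pi.smul_apply, smul_eq_mul]

/-- **`W` acts by `im` on weight-`m` functions**: `(W φ)(g) = d/dθ φ(g k_θ)|₀ = im φ(g)`
(Bump 1997, (2.33): `dH = -i ∂_θ`, `H = -iW`, so `H` acts by `m`). No smoothness is needed: the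
restriction to the one-parameter subgroup is the explicit function `e^{imθ} φ(g)`.
[cite: Bump1997, (2.33)] -/
theorem lieDeriv_rotGen (hφ : IsWeightVec ι m φ) :
    lieDeriv ι (toLie rotGen) φ = (Complex.I * m) • φ := by
  funext g
  have h : (fun t : ℝ => φ (g * ι ((RealMatrixGroup.gl ℝ (Fin 2)).expMem (t • toLie rotGen)))) =
      fun t : ℝ => φ g * Complex.exp ((m : ℂ) * Complex.I * (t : ℂ)) := by
    funext t
    rw [← rotK_eq_expMem, hφ t g]
    ring_nf
  change deriv (fun t : ℝ => φ (g * ι ((RealMatrixGroup.gl ℝ (Fin 2)).expMem (t • toLie rotGen)))) 0 = _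
  rw [h]
  have hc : HasDerivAt (fun w : ℂ => Complex.exp ((m : ℂ) * Complex.I * w))
      (Complex.exp ((m : ℂ) * Complex.I * ((0 : ℝ) : ℂ)) * ((m : ℂ) * Complex.I * 1)) ((0 : ℝ) : ℂ) :=
    ((hasDerivAt_id ((0 : ℝ) : ℂ)).const_mul ((m : ℂ) * Complex.I)).cexp
  have hd : HasDerivAt (fun t : ℝ => φ g * Complex.exp ((m : ℂ) * Complex.I * (t : ℂ)))
      (φ g * (Complex.exp ((m : ℂ) * Complex.I * ((0 : ℝ) : ℂ)) * ((m : ℂ) * Complex.I * 1))) 0 :=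
    hc.comp_ofReal.const_mul (φ g)
  rw [hd.deriv, Pi.smul_apply, smul_eq_mul]
  simp only [Complex.ofReal_zero, mul_zero, Complex.exp_zero, mul_one, one_mul]
  ring

/-- **The reflection `ε` negates the weight**: `r(ε) φ` has weight `-m` if `φ` has weight `m`
(`k_θ ε = ε k_{-θ}`). [folklore] -/
theorem archTranslate_epsK (hφ : IsWeightVec ι m φ) : IsWeightVec ι (-m) (archTranslate ι epsK φ) := by
  intro θ g
  simp only [archTranslate_apply]
  have hk0 : rotK θ * epsK = epsK * rotK (-θ) := by
    rw [← epsK_mul_rotK_mul_epsK, ← mul_assoc, ← mul_assoc, epsK_mul_epsK, one_mul]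
  have hk : ι (rotK θ) * ι epsK = ι epsK * ι (rotK (-θ)) := by rw [← map_mul, ← map_mul, hk0]
  rw [mul_assoc, hk, ← mul_assoc, hφ (-θ) (g * ι epsK)]
  push_cast
  ring_nf

/-- A weight-`m` function satisfies `φ(g k_π) = (-1)^m φ(g)`, i.e. `-1 ∈ SO(2)` acts by `(-1)^m`. [folklore] -/
theorem apply_mul_rotK_pi (hφ : IsWeightVec ι m φ) (g : G) :
    φ (g * ι (rotK Real.pi)) = (-1 : ℂ) ^ m * φ g := by
  rw [hφ Real.pi g, ← Complex.exp_pi_mul_I, ← Complex.exp_int_mul, mul_assoc]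

/-- **Parity**: if `-1 = k_π` acts by `-1` on a non-zero function of weight `m`, then `m` is odd
(Gelbart 1997, proof of Prop. 4.2: oddness singles out `π(1, sgn)`; here at the level of
`K`-types: `(-1)^m = -1`). [cite: Gelbart1997, Prop. 4.2 (proof)] -/
theorem odd (hφ : IsWeightVec ι m φ) (hneg : ∀ g, φ (g * ι (rotK Real.pi)) = -φ g) (h0 : φ ≠ 0) :
    Odd m := by
  obtain ⟨g, hg⟩ : ∃ g, φ g ≠ 0 := Function.ne_iff.1 h0
  have h1 : (-1 : ℂ) ^ m * φ g = -φ g := by rw [← apply_mul_rotK_pi hφ g, hneg g]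
  have h2 : (-1 : ℂ) ^ m = -1 := by
    have h3 : ((-1 : ℂ) ^ m + 1) * φ g = 0 := by linear_combination h1
    have h4 : (-1 : ℂ) ^ m + 1 = 0 := (mul_eq_zero.1 h3).resolve_right hg
    linear_combination h4
  rcases Int.even_or_odd m with he | ho
  · rw [he.neg_one_zpow] at h2; norm_num at h2
  · exact ho

end IsWeightVec

/-! ### A finite-dimensional space of functions stable under the rotations contains a weight vector -/

/-- **A finite-dimensional rotation-stable space of archimedean-smooth functions is stable under
`W`**: `W φ = lim_{θ → 0} (r(k_θ) φ - φ)/θ` pointwise, and a finite-dimensional subspace of `G → ℂ`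
is closed for the topology of pointwise convergence. Borel–Jacquet 1979, §1.3 (a `K`-finite vector
generates a finite-dimensional `K`-, hence `𝔨`-, module). [cite: BorelJacquetCorvallis1979, §1.3] -/
theorem lieDeriv_rotGen_mem_of_finiteDimensional {V : Submodule ℂ (G → ℂ)} [FiniteDimensional ℂ V]
    (hrot : ∀ θ : ℝ, ∀ φ ∈ V, archTranslate ι (rotK θ) φ ∈ V)
    {φ : G → ℂ} (hφV : φ ∈ V) (hφ : IsArchSmooth ι φ) :
    lieDeriv ι (toLie rotGen) φ ∈ V := by
  have hclosed : IsClosed (V : Set (G → ℂ)) := V.closed_of_finiteDimensional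
  -- the difference quotients lie in `V` and converge pointwise to `W φ`
  have hlim : Tendsto (fun t : ℝ => t⁻¹ • (archTranslate ι (rotK t) φ - φ)) (𝓝[≠] 0)
      (𝓝 (lieDeriv ι (toLie rotGen) φ)) := by
    rw [tendsto_pi_nhds]
    intro g
    have hd := hφ.hasDerivAt_flow_zero ι (toLie rotGen) g
    have ht := hd.tendsto_slope_zero
    refine ht.congr fun t => ?_
    simp only [Pi.smul_apply, Pi.sub_apply, archTranslate_apply, zero_add, rotK_eq_expMem, zero_smul,
      expMem_zero_gl2, map_one, mul_one]
  have hmem : ∀ᶠ t : ℝ in 𝓝[≠] 0, t⁻¹ • (archTranslate ι (rotK t) φ - φ) ∈ (V : Set (G → ℂ)) :=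
    Eventually.of_forall fun t => by
      rw [← Complex.coe_smul]
      exact V.smul_mem _ (V.sub_mem (hrot t φ hφV) hφV)
  exact hclosed.mem_of_tendsto hlim hmem

/-- **A one-parameter eigenfunction of `W` is a weight vector.** If `φ` is archimedean-smooth and
`W φ = c φ`, then `φ(g k_θ) = e^{cθ} φ(g)` (`d/dθ (e^{-cθ} φ(g k_θ)) = 0`), and if moreover `φ ≠ 0`
then `e^{2πc} = 1`, so `c = im` with `m ∈ ℤ` and `φ` has weight `m`. Bump 1997, proof of
Prop. 2.2.5 ((2.33)–(2.36)). [cite: Bump1997, Prop. 2.2.5 (proof)] -/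
theorem exists_isWeightVec_of_lieDeriv_rotGen_eq_smul {φ : G → ℂ} (hφ : IsArchSmooth ι φ) {c : ℂ}
    (hc : lieDeriv ι (toLie rotGen) φ = c • φ) (h0 : φ ≠ 0) : ∃ m : ℤ, IsWeightVec ι m φ := by
  -- Step 1: `φ(g k_θ) = e^{cθ} φ(g)`
  have hflow : ∀ (g : G) (θ : ℝ), φ (g * ι (rotK θ)) = Complex.exp (c * θ) * φ g := by
    intro g θ
    set F : ℝ → ℂ := fun t => φ (g * ι ((RealMatrixGroup.gl ℝ (Fin 2)).expMem (t • toLie rotGen))) with hF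
    have hFd : ∀ s : ℝ, HasDerivAt F (c * F s) s := by
      intro s
      have h := hφ.hasDerivAt_flow ι (toLie rotGen) g s
      rw [hc] at h
      simpa only [hF, Pi.smul_apply, smul_eq_mul] using h
    -- `u(t) = e^{-ct} F(t)` is constant
    set u : ℝ → ℂ := fun t => Complex.exp (-(c * t)) * F t with hu
    have hud : ∀ s : ℝ, HasDerivAt u 0 s := by
      intro s
      have h1 : HasDerivAt (fun t : ℝ => Complex.exp (-(c * t))) (Complex.exp (-(c * s)) * (-(c * 1))) s := by
        have h2 : HasDerivAt (fun w : ℂ => Complex.exp (-(c * w))) (Complex.exp (-(c * (s : ℂ))) * (-(c * 1))) (s : ℂ) :=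
          (((hasDerivAt_id (s : ℂ)).const_mul c).neg).cexp
        exact h2.comp_ofReal
      have h3 := h1.mul (hFd s)
      have h4 : Complex.exp (-(c * s)) * (-(c * 1)) * F s + Complex.exp (-(c * s)) * (c * F s) = 0 := by ring
      rwa [h4] at h3
    have hconst : ∀ t : ℝ, u t = u 0 := by
      have hdiff : Differentiable ℝ u := fun s => (hud s).differentiableAt
      exact fun t => is_const_of_deriv_eq_zero hdiff (fun s => (hud s).deriv) t 0
    have h1 := hconst θ
    simp only [hu, hF, zero_smul, mul_zero, neg_zero, Complex.exp_zero, one_mul, Complex.ofReal_zero,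
      expMem_zero_gl2, map_one, mul_one] at h1
    rw [← rotK_eq_expMem] at h1
    have h3 : Complex.exp (c * θ) * (Complex.exp (-(c * θ)) * φ (g * ι (rotK θ))) = Complex.exp (c * θ) * φ g := by
      rw [h1]
    rw [← mul_assoc, ← Complex.exp_add, add_neg_cancel, Complex.exp_zero, one_mul] at h3
    exact h3
  -- Step 2: `e^{2πc} = 1`, so `c = im`
  obtain ⟨g, hg⟩ : ∃ g, φ g ≠ 0 := Function.ne_iff.1 h0
  have hper : Complex.exp (c * (2 * Real.pi)) = 1 := by
    have h := hflow g (2 * Real.pi)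
    rw [rotK_two_pi, map_one, mul_one] at h
    have h' : (Complex.exp (c * (2 * Real.pi)) - 1) * φ g = 0 := by
      push_cast at h
      linear_combination -h
    have h'' := (mul_eq_zero.1 h').resolve_right hg
    linear_combination h''
  obtain ⟨n, hn⟩ := Complex.exp_eq_one_iff.1 hper
  refine ⟨n, fun θ g' => ?_⟩
  rw [hflow g' θ]
  congr 1
  have hc' : c = n * Complex.I := by
    have h2 : c * (2 * Real.pi) = (n * Complex.I) * (2 * Real.pi) := by rw [hn]; ring
    have hpi : (2 * (Real.pi : ℂ)) ≠ 0 := by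
      exact mul_ne_zero two_ne_zero (by exact_mod_cast Real.pi_ne_zero)
    exact mul_right_cancel₀ hpi h2
  rw [hc']
  ring_nf

/-- **A non-zero finite-dimensional space of archimedean-smooth functions stable under the rotations
contains a non-zero weight vector**: `W` preserves the space
(`lieDeriv_rotGen_mem_of_finiteDimensional`) and is `ℂ`-linear on it, hence has an eigenvector
(`ℂ` algebraically closed), which is a weight vector
(`exists_isWeightVec_of_lieDeriv_rotGen_eq_smul`). This is the decomposition of a `K`-finite
vector into `SO(2)`-types (Borel–Jacquet 1979, §1.3; Bump 1997, §2.1), in the weak form needed here.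
[cite: BorelJacquetCorvallis1979, §1.3] -/
theorem exists_isWeightVec_mem_of_finiteDimensional {V : Submodule ℂ (G → ℂ)} [FiniteDimensional ℂ V]
    (hV : V ≠ ⊥) (hrot : ∀ θ : ℝ, ∀ φ ∈ V, archTranslate ι (rotK θ) φ ∈ V)
    (hsmooth : ∀ φ ∈ V, IsArchSmooth ι φ) :
    ∃ (m : ℤ) (φ : G → ℂ), φ ∈ V ∧ φ ≠ 0 ∧ IsWeightVec ι m φ := by
  -- `W` restricted to `V`
  let D : V →ₗ[ℂ] V :=
    { toFun := fun v => ⟨lieDeriv ι (toLie rotGen) (v : G → ℂ),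
        lieDeriv_rotGen_mem_of_finiteDimensional hrot v.2 (hsmooth _ v.2)⟩
      map_add' := fun v w => Subtype.ext (by
        change lieDeriv ι (toLie rotGen) ((v : G → ℂ) + (w : G → ℂ)) = _
        rw [IsArchSmooth.lieDeriv_add ι (toLie rotGen) (hsmooth _ v.2) (hsmooth _ w.2)]
        rfl)
      map_smul' := fun a v => Subtype.ext (by
        change lieDeriv ι (toLie rotGen) (a • (v : G → ℂ)) = _
        rw [lieDeriv_smul]
        rfl) }
  haveI : Nontrivial V := Submodule.nontrivial_iff_ne_bot.2 hV
  obtain ⟨c, hcev⟩ := Module.End.exists_eigenvalue D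
  obtain ⟨v, hv⟩ := hcev.exists_hasEigenvector
  have hv0 : (v : G → ℂ) ≠ 0 := fun h => hv.2 (Subtype.ext h)
  have hDv : lieDeriv ι (toLie rotGen) (v : G → ℂ) = c • (v : G → ℂ) := by
    have h := hv.apply_eq_smul
    exact congrArg Subtype.val h
  obtain ⟨m, hm⟩ := exists_isWeightVec_of_lieDeriv_rotGen_eq_smul (hsmooth _ v.2) hDv hv0
  exact ⟨m, v, v.2, hv0, hm⟩

end Weights

/-! ### The raising and lowering operators and the Casimir operator as (complexified) Lie derivatives -/

section Operators

variable {G : Type*} [Group G] (ι : (RealMatrixGroup.gl ℝ (Fin 2)).carrier →* G)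

/-- `h = E₁₁ - E₂₂ = diag(1, -1)`. [folklore] -/
def hMat : Matrix (Fin 2) (Fin 2) ℝ := e₁₁ - e₂₂

/-- `a = E₁₂ + E₂₁ = (0 1; 1 0)`. [folklore] -/
def aMat : Matrix (Fin 2) (Fin 2) ℝ := e₁₂ + e₂₁

/-- **The lowering operator** `X = h - i(E₁₂ + E₂₁) = (1 -i; -i -1) ∈ 𝔤𝔩₂(ℝ)_ℂ` (Gelbart 1997,
(2.5.4) (v); twice Bump's `L`, Bump 1997, (2.23)) acting on functions on `G` through the
(complexified) Lie derivative along `ι`: `X φ = h φ - i (E₁₂ φ + E₂₁ φ)`. For `G = GL₂(ℝ)`, `ι` the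
identity, `(lowerFun ι F) g` is `GL2Real.lowering F g` (`lowerFun_incl_apply`).
[cite: Gelbart1997, (2.5.4) (v)] [cite: Bump1997, (2.23)] -/
def lowerFun (φ : G → ℂ) : G → ℂ :=
  lieDeriv ι (toLie hMat) φ - Complex.I • (lieDeriv ι (toLie e₁₂) φ + lieDeriv ι (toLie e₂₁) φ)

/-- **The raising operator** `X̄ = h + i(E₁₂ + E₂₁) = (1 i; i -1)` (twice Bump's `R`, Bump 1997,
(2.23)) as a complexified Lie derivative. [cite: Bump1997, (2.23)] -/
def raiseFun (φ : G → ℂ) : G → ℂ :=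
  lieDeriv ι (toLie hMat) φ + Complex.I • (lieDeriv ι (toLie e₁₂) φ + lieDeriv ι (toLie e₂₁) φ)

/-- **The Casimir operator** of `𝔰𝔩₂`, `Ω = ½ h² + E₁₂E₂₁ + E₂₁E₁₂ ∈ Z(U(𝔤𝔩₂))`, acting through
iterated Lie derivatives (Bump 1997, §2.2: `-4Δ = H² + 2RL + 2LR`, and `½H² + RL + LR = Ω`, the
Casimir being independent of the basis; in terms of the Casimir `C = ∑ E_{ab}E_{ba}` of `𝔤𝔩₂`,
`Ω = C - ½ Z²`, `Z = E₁₁ + E₂₂`). [cite: Bump1997, §2.2 (Prop. 2.2.5, (1.29))] -/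
def casimirFun (φ : G → ℂ) : G → ℂ :=
  (1 / 2 : ℂ) • lieDeriv ι (toLie hMat) (lieDeriv ι (toLie hMat) φ) +
    lieDeriv ι (toLie e₁₂) (lieDeriv ι (toLie e₂₁) φ) + lieDeriv ι (toLie e₂₁) (lieDeriv ι (toLie e₁₂) φ)

/-- On `GL₂(ℝ)` itself, `lowerFun` is the operator `GL2Real.lowering` of
`NewformAdelisationDescentHolomorphy` (there `E₁₁ - E₂₂` is written for `h`). [folklore] -/
theorem lowerFun_incl_apply (F : GL (Fin 2) ℝ → ℂ) (g : GL (Fin 2) ℝ) :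
    lowerFun incl F g = lowering F g := rfl

variable {ι}

/-- The Lie algebra of `GL₂(ℝ)` as a linear real group is all of `𝔤𝔩₂(ℝ)` (definitional). [folklore] -/
theorem gl2_lie_eq_top : (RealMatrixGroup.gl ℝ (Fin 2)).lie = ⊤ := rfl

/-- The carrier of `GL₂(ℝ)` as a linear real group is all of `GL (Fin 2) ℝ` (definitional). [folklore] -/
theorem gl2_carrier_eq_top : (RealMatrixGroup.gl ℝ (Fin 2)).carrier = ⊤ := rfl

/-- Lie derivatives of archimedean-smooth functions are archimedean-smooth (`GL₂(ℝ)` case of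
`isArchSmooth_lieDeriv_of_lie_eq_top`). [cite: BorelJacquetCorvallis1979, §1.5] -/
theorem isArchSmooth_lieDeriv_toLie {φ : G → ℂ} (hφ : IsArchSmooth ι φ) (X : Matrix (Fin 2) (Fin 2) ℝ) :
    IsArchSmooth ι (lieDeriv ι (toLie X) φ) :=
  isArchSmooth_lieDeriv_of_lie_eq_top ι gl2_lie_eq_top (toLie X) hφ

/-- Subtraction rule for the Lie derivative on archimedean-smooth functions. [folklore] -/
theorem lieDeriv_sub_of_isArchSmooth (X : (RealMatrixGroup.gl ℝ (Fin 2)).lie) {φ ψ : G → ℂ}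
    (hφ : IsArchSmooth ι φ) (hψ : IsArchSmooth ι ψ) :
    lieDeriv ι X (φ - ψ) = lieDeriv ι X φ - lieDeriv ι X ψ := by
  rw [sub_eq_add_neg, IsArchSmooth.lieDeriv_add ι X hφ (by simpa using hψ.smul ι (-1)),
    show -ψ = (-1 : ℂ) • ψ by simp, lieDeriv_smul]
  simp [sub_eq_add_neg]

/-- The lowering operator preserves archimedean smoothness. [folklore] -/
theorem isArchSmooth_lowerFun {φ : G → ℂ} (hφ : IsArchSmooth ι φ) : IsArchSmooth ι (lowerFun ι φ) := by
  have h1 := isArchSmooth_lieDeriv_toLie hφ hMat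
  have h2 := ((isArchSmooth_lieDeriv_toLie hφ e₁₂).add ι (isArchSmooth_lieDeriv_toLie hφ e₂₁)).smul ι Complex.I
  have h3 : lowerFun ι φ = lieDeriv ι (toLie hMat) φ +
      (-1 : ℂ) • (Complex.I • (lieDeriv ι (toLie e₁₂) φ + lieDeriv ι (toLie e₂₁) φ)) := by
    rw [lowerFun, sub_eq_add_neg, neg_one_smul]
  rw [h3]
  exact h1.add ι (h2.smul ι (-1))

/-- The raising operator preserves archimedean smoothness. [folklore] -/
theorem isArchSmooth_raiseFun {φ : G → ℂ} (hφ : IsArchSmooth ι φ) : IsArchSmooth ι (raiseFun ι φ) := by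
  unfold raiseFun
  exact (isArchSmooth_lieDeriv_toLie hφ hMat).add ι (((isArchSmooth_lieDeriv_toLie hφ e₁₂).add ι (isArchSmooth_lieDeriv_toLie hφ e₂₁)).smul ι Complex.I)

/-- `X 0 = 0`. [folklore] -/
@[simp] theorem lowerFun_zero : lowerFun ι (0 : G → ℂ) = 0 := by
  simp [lowerFun]

/-- `X̄ 0 = 0`. [folklore] -/
@[simp] theorem raiseFun_zero : raiseFun ι (0 : G → ℂ) = 0 := by
  simp [raiseFun]

/-! #### The adjoint action of `k_θ` and `ε` on `h` and `E₁₂ + E₂₁` -/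

/-- `r(θ)⁻¹ = r(-θ)`. [folklore] -/
theorem rotGL_inv (θ : ℝ) : (rotGL θ)⁻¹ = rotGL (-θ) :=
  inv_eq_of_mul_eq_one_right (by rw [rotGL_mul_rotGL, add_neg_cancel, rotGL_zero])

/-- **`Ad(k_θ) h = cos 2θ · h - sin 2θ · (E₁₂ + E₂₁)`** (the plane spanned by `h` and `E₁₂ + E₂₁`
is rotated by the angle `2θ`; equivalently `Ad(k_θ)` multiplies `h ∓ i(E₁₂ + E₂₁)` by `e^{∓2iθ}`,
Bump 1997, (2.31)–(2.32): the factors `e^{±2iθ}` in `dR`, `dL`). [cite: Bump1997, Prop. 2.2.5] -/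
theorem Ad_rotK_hMat (θ : ℝ) :
    (RealMatrixGroup.gl ℝ (Fin 2)).Ad (rotK θ) (toLie hMat) =
      Real.cos (2 * θ) • toLie hMat - Real.sin (2 * θ) • toLie aMat := by
  refine Subtype.ext ?_
  change ((rotGL (-θ) : GL (Fin 2) ℝ) : Matrix (Fin 2) (Fin 2) ℝ) * hMat *
      (((rotGL (-θ))⁻¹ : GL (Fin 2) ℝ) : Matrix (Fin 2) (Fin 2) ℝ) =
    Real.cos (2 * θ) • hMat - Real.sin (2 * θ) • aMat
  rw [rotGL_inv, neg_neg, coe_rotGL, coe_rotGL, Real.cos_neg, Real.sin_neg, hMat, aMat, e₁₁, e₂₂, e₁₂, e₂₁,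
    Real.cos_two_mul, Real.sin_two_mul]
  ext i j
  fin_cases i <;> fin_cases j <;> simp [Matrix.mul_apply, Fin.sum_univ_two] <;>
    nlinarith [Real.cos_sq_add_sin_sq θ]

/-- **`Ad(k_θ) (E₁₂ + E₂₁) = sin 2θ · h + cos 2θ · (E₁₂ + E₂₁)`.** [cite: Bump1997, Prop. 2.2.5] -/
theorem Ad_rotK_aMat (θ : ℝ) :
    (RealMatrixGroup.gl ℝ (Fin 2)).Ad (rotK θ) (toLie aMat) =
      Real.sin (2 * θ) • toLie hMat + Real.cos (2 * θ) • toLie aMat := by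
  refine Subtype.ext ?_
  change ((rotGL (-θ) : GL (Fin 2) ℝ) : Matrix (Fin 2) (Fin 2) ℝ) * aMat *
      (((rotGL (-θ))⁻¹ : GL (Fin 2) ℝ) : Matrix (Fin 2) (Fin 2) ℝ) =
    Real.sin (2 * θ) • hMat + Real.cos (2 * θ) • aMat
  rw [rotGL_inv, neg_neg, coe_rotGL, coe_rotGL, Real.cos_neg, Real.sin_neg, hMat, aMat, e₁₁, e₂₂, e₁₂, e₂₁,
    Real.cos_two_mul, Real.sin_two_mul]
  ext i j
  fin_cases i <;> fin_cases j <;> simp [Matrix.mul_apply, Fin.sum_univ_two] <;>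
    nlinarith [Real.cos_sq_add_sin_sq θ]

/-- `ε⁻¹ = ε`. [folklore] -/
theorem epsGL_inv : (epsGL : GL (Fin 2) ℝ)⁻¹ = epsGL :=
  inv_eq_of_mul_eq_one_right epsGL_mul_epsGL

/-- `Ad(ε) h = h`. [folklore] -/
theorem Ad_epsK_hMat : (RealMatrixGroup.gl ℝ (Fin 2)).Ad epsK (toLie hMat) = toLie hMat := by
  refine Subtype.ext ?_
  change ((epsGL : GL (Fin 2) ℝ) : Matrix (Fin 2) (Fin 2) ℝ) * hMat *
      (((epsGL)⁻¹ : GL (Fin 2) ℝ) : Matrix (Fin 2) (Fin 2) ℝ) = hMat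
  rw [epsGL_inv, coe_epsGL, hMat, e₁₁, e₂₂]
  ext i j
  fin_cases i <;> fin_cases j <;> simp [Matrix.mul_apply, Fin.sum_univ_two]

/-- `Ad(ε) E₁₂ = -E₁₂`. [folklore] -/
theorem Ad_epsK_e₁₂ : (RealMatrixGroup.gl ℝ (Fin 2)).Ad epsK (toLie e₁₂) = -toLie e₁₂ := by
  refine Subtype.ext ?_
  change ((epsGL : GL (Fin 2) ℝ) : Matrix (Fin 2) (Fin 2) ℝ) * e₁₂ *
      (((epsGL)⁻¹ : GL (Fin 2) ℝ) : Matrix (Fin 2) (Fin 2) ℝ) = -e₁₂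
  rw [epsGL_inv, coe_epsGL, e₁₂]
  ext i j
  fin_cases i <;> fin_cases j <;> simp [Matrix.mul_apply, Fin.sum_univ_two]

/-- `Ad(ε) E₂₁ = -E₂₁`. [folklore] -/
theorem Ad_epsK_e₂₁ : (RealMatrixGroup.gl ℝ (Fin 2)).Ad epsK (toLie e₂₁) = -toLie e₂₁ := by
  refine Subtype.ext ?_
  change ((epsGL : GL (Fin 2) ℝ) : Matrix (Fin 2) (Fin 2) ℝ) * e₂₁ *
      (((epsGL)⁻¹ : GL (Fin 2) ℝ) : Matrix (Fin 2) (Fin 2) ℝ) = -e₂₁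
  rw [epsGL_inv, coe_epsGL, e₂₁]
  ext i j
  fin_cases i <;> fin_cases j <;> simp [Matrix.mul_apply, Fin.sum_univ_two]

/-- `toLie` is additive. [folklore] -/
theorem toLie_add (X Y : Matrix (Fin 2) (Fin 2) ℝ) : toLie (X + Y) = toLie X + toLie Y := rfl

/-- `toLie` is `ℝ`-homogeneous. [folklore] -/
theorem toLie_smul (a : ℝ) (X : Matrix (Fin 2) (Fin 2) ℝ) : toLie (a • X) = a • toLie X := rfl

/-- `toLie` respects negation. [folklore] -/
theorem toLie_neg (X : Matrix (Fin 2) (Fin 2) ℝ) : toLie (-X) = -toLie X := rfl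

/-- `E₁₂ φ + E₂₁ φ = (E₁₂ + E₂₁) φ` for archimedean-smooth `φ`. [folklore] -/
theorem lieDeriv_e₁₂_add_lieDeriv_e₂₁ {φ : G → ℂ} (hφ : IsArchSmooth ι φ) :
    lieDeriv ι (toLie e₁₂) φ + lieDeriv ι (toLie e₂₁) φ = lieDeriv ι (toLie aMat) φ := by
  rw [aMat, toLie_add, hφ.lieDeriv_add_left ι]

/-- `ℝ`-linear combinations in the Lie algebra argument, on archimedean-smooth functions:
`(a X + b Y) φ = a Xφ + b Yφ` and `(a X - b Y) φ = a Xφ - b Yφ`. [folklore] -/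
theorem lieDeriv_smul_add_smul_of_isArchSmooth {φ : G → ℂ} (hφ : IsArchSmooth ι φ) (a b : ℝ)
    (X Y : (RealMatrixGroup.gl ℝ (Fin 2)).lie) :
    lieDeriv ι (a • X + b • Y) φ = a • lieDeriv ι X φ + b • lieDeriv ι Y φ := by
  rw [hφ.lieDeriv_add_left ι, hφ.lieDeriv_smul_left ι, hφ.lieDeriv_smul_left ι]

/-- `(a X - b Y) φ = a Xφ - b Yφ` on archimedean-smooth `φ`. [folklore] -/
theorem lieDeriv_smul_sub_smul_of_isArchSmooth {φ : G → ℂ} (hφ : IsArchSmooth ι φ) (a b : ℝ)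
    (X Y : (RealMatrixGroup.gl ℝ (Fin 2)).lie) :
    lieDeriv ι (a • X - b • Y) φ = a • lieDeriv ι X φ - b • lieDeriv ι Y φ := by
  rw [sub_eq_add_neg, ← neg_smul, lieDeriv_smul_add_smul_of_isArchSmooth hφ a (-b) X Y, neg_smul, ← sub_eq_add_neg]

/-! #### Weight shifts -/

/-- `e^{imθ} (cos 2θ - i sin 2θ) = e^{i(m-2)θ}` and `sin 2θ + i cos 2θ = i (cos 2θ - i sin 2θ)`: the
scalar identities behind the weight shift. [folklore] -/
theorem exp_mul_cos_sub_I_sin (m : ℤ) (θ : ℝ) :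
    Complex.exp (m * θ * Complex.I) * ((Real.cos (2 * θ) : ℂ) - Complex.I * (Real.sin (2 * θ) : ℂ)) =
      Complex.exp (((m - 2 : ℤ) : ℂ) * θ * Complex.I) := by
  have h : ((Real.cos (2 * θ) : ℂ) - Complex.I * (Real.sin (2 * θ) : ℂ)) = Complex.exp (-(2 * θ) * Complex.I) := by
    rw [Complex.exp_mul_I]
    push_cast
    rw [Complex.cos_neg, Complex.sin_neg]
    ring
  rw [h, ← Complex.exp_add]
  congr 1
  push_cast
  ring

/-- **The lowering operator lowers the weight by `2`**: if `φ` is archimedean-smooth of weight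
`m`, then `X φ` has weight `m - 2` (`r(k_θ)(Y φ) = (Ad(k_θ) Y)(r(k_θ) φ)` and
`Ad(k_θ) X = e^{-2iθ} X`). Bump 1997, §2.1 (the operators `L_k : weight k → weight k - 2`) and
Prop. 2.2.5. [cite: Bump1997, Prop. 2.2.5] -/
theorem IsWeightVec.weight_lowerFun {m : ℤ} {φ : G → ℂ} (hw : IsWeightVec ι m φ) (hφ : IsArchSmooth ι φ) :
    IsWeightVec ι (m - 2) (lowerFun ι φ) := by
  intro θ g
  have hsm : IsArchSmooth ι (archTranslate ι (rotK θ) φ) := by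
    rw [hw.archTranslate_rotK θ]; exact hφ.smul ι _
  have key : archTranslate ι (rotK θ) (lowerFun ι φ) =
      Complex.exp (((m - 2 : ℤ) : ℂ) * θ * Complex.I) • lowerFun ι φ := by
    unfold lowerFun
    rw [lieDeriv_e₁₂_add_lieDeriv_e₂₁ hφ, map_sub, map_smul, archTranslate_lieDeriv ι, archTranslate_lieDeriv ι,
      Ad_rotK_hMat, Ad_rotK_aMat, lieDeriv_smul_sub_smul_of_isArchSmooth hsm, lieDeriv_smul_add_smul_of_isArchSmooth hsm,
      hw.archTranslate_rotK θ, lieDeriv_smul, lieDeriv_smul]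
    funext x
    simp only [Pi.sub_apply, Pi.smul_apply, Pi.add_apply, smul_eq_mul, Complex.real_smul]
    rw [← exp_mul_cos_sub_I_sin m θ]
    linear_combination (-(Complex.exp (m * θ * Complex.I) * (Real.sin (2 * θ) : ℂ) *
      lieDeriv ι (toLie aMat) φ x)) * Complex.I_sq
  have h := congrFun key g
  rw [archTranslate_apply] at h
  rw [h, Pi.smul_apply, smul_eq_mul]

/-- **The raising operator raises the weight by `2`.** [cite: Bump1997, Prop. 2.2.5] -/
theorem IsWeightVec.weight_raiseFun {m : ℤ} {φ : G → ℂ} (hw : IsWeightVec ι m φ) (hφ : IsArchSmooth ι φ) :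
    IsWeightVec ι (m + 2) (raiseFun ι φ) := by
  intro θ g
  have hsm : IsArchSmooth ι (archTranslate ι (rotK θ) φ) := by
    rw [hw.archTranslate_rotK θ]; exact hφ.smul ι _
  have hexp : Complex.exp (m * θ * Complex.I) * ((Real.cos (2 * θ) : ℂ) + Complex.I * (Real.sin (2 * θ) : ℂ)) =
      Complex.exp (((m + 2 : ℤ) : ℂ) * θ * Complex.I) := by
    have h : ((Real.cos (2 * θ) : ℂ) + Complex.I * (Real.sin (2 * θ) : ℂ)) = Complex.exp ((2 * θ) * Complex.I) := by
      rw [Complex.exp_mul_I]; push_cast; ring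
    rw [h, ← Complex.exp_add]; congr 1; push_cast; ring
  have key : archTranslate ι (rotK θ) (raiseFun ι φ) =
      Complex.exp (((m + 2 : ℤ) : ℂ) * θ * Complex.I) • raiseFun ι φ := by
    unfold raiseFun
    rw [lieDeriv_e₁₂_add_lieDeriv_e₂₁ hφ, map_add, map_smul, archTranslate_lieDeriv ι, archTranslate_lieDeriv ι,
      Ad_rotK_hMat, Ad_rotK_aMat, lieDeriv_smul_sub_smul_of_isArchSmooth hsm, lieDeriv_smul_add_smul_of_isArchSmooth hsm,
      hw.archTranslate_rotK θ, lieDeriv_smul, lieDeriv_smul]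
    funext x
    simp only [Pi.sub_apply, Pi.smul_apply, Pi.add_apply, smul_eq_mul, Complex.real_smul]
    rw [← hexp]
    linear_combination (-(Complex.exp (m * θ * Complex.I) * (Real.sin (2 * θ) : ℂ) *
      lieDeriv ι (toLie aMat) φ x)) * Complex.I_sq
  have h := congrFun key g
  rw [archTranslate_apply] at h
  rw [h, Pi.smul_apply, smul_eq_mul]

/-- **`ε` exchanges the lowering and the raising operator**: `r(ε) (X̄ ψ) = X (r(ε) ψ)`
(`Ad(ε) h = h`, `Ad(ε) E₁₂ = -E₁₂`, `Ad(ε) E₂₁ = -E₂₁`), for `r(ε) ψ` archimedean-smooth. [folklore] -/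
theorem archTranslate_epsK_raiseFun {ψ : G → ℂ} (hεψ : IsArchSmooth ι (archTranslate ι epsK ψ)) :
    archTranslate ι epsK (raiseFun ι ψ) = lowerFun ι (archTranslate ι epsK ψ) := by
  unfold raiseFun lowerFun
  rw [map_add, map_smul, map_add, archTranslate_lieDeriv ι, archTranslate_lieDeriv ι, archTranslate_lieDeriv ι,
    Ad_epsK_hMat, Ad_epsK_e₁₂, Ad_epsK_e₂₁, (neg_one_smul ℝ (toLie e₁₂)).symm,
    (neg_one_smul ℝ (toLie e₂₁)).symm, hεψ.lieDeriv_smul_left ι, hεψ.lieDeriv_smul_left ι]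
  funext x
  simp only [Pi.add_apply, Pi.sub_apply, Pi.smul_apply, smul_eq_mul, Complex.real_smul]
  push_cast
  ring

/-! #### `X̄ X = 2Ω + W² - 2iW` on archimedean-smooth functions -/

/-- `[h, E₁₂] = 2 E₁₂` in `𝔤𝔩₂(ℝ)`. [folklore] -/
theorem lie_hMat_e₁₂ : ⁅toLie hMat, toLie e₁₂⁆ = (2 : ℝ) • toLie e₁₂ := by
  refine Subtype.ext ?_
  change hMat * e₁₂ - e₁₂ * hMat = (2 : ℝ) • e₁₂
  rw [hMat, e₁₁, e₂₂, e₁₂]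
  ext i j
  fin_cases i <;> fin_cases j <;> norm_num

/-- `[h, E₂₁] = -2 E₂₁` in `𝔤𝔩₂(ℝ)`. [folklore] -/
theorem lie_hMat_e₂₁ : ⁅toLie hMat, toLie e₂₁⁆ = (-2 : ℝ) • toLie e₂₁ := by
  refine Subtype.ext ?_
  change hMat * e₂₁ - e₂₁ * hMat = (-2 : ℝ) • e₂₁
  rw [hMat, e₁₁, e₂₂, e₂₁]
  ext i j
  fin_cases i <;> fin_cases j <;> norm_num

/-- `W = E₁₂ - E₂₁`, so `W φ = E₁₂ φ - E₂₁ φ` for archimedean-smooth `φ`. [folklore] -/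
theorem lieDeriv_rotGen_eq_sub {φ : G → ℂ} (hφ : IsArchSmooth ι φ) :
    lieDeriv ι (toLie rotGen) φ = lieDeriv ι (toLie e₁₂) φ - lieDeriv ι (toLie e₂₁) φ := by
  rw [rotGen_eq, show toLie (e₁₂ - e₂₁) = toLie e₁₂ - toLie e₂₁ from rfl, sub_eq_add_neg,
    (neg_one_smul ℝ (toLie e₂₁)).symm, hφ.lieDeriv_add_left ι, hφ.lieDeriv_smul_left ι]
  funext x; simp [sub_eq_add_neg]

/-- **`X̄ (X φ) = 2 Ω φ + W (W φ) - 2i W φ`** for archimedean-smooth `φ` — the identity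
`4RL = -4Δ - H² + 2H` of `U(𝔤𝔩₂(ℝ)_ℂ)` (Bump 1997, §2.2: `-4Δ = H² + 2RL + 2LR`, `[R, L] = H`,
`H = -iW`, and `-4Δ = 2Ω`), obtained on functions from the bracket relations
`E₁₂(hφ) - h(E₁₂φ) = -[h, E₁₂]φ = -2 E₁₂ φ`, `E₂₁(hφ) - h(E₂₁φ) = 2 E₂₁ φ`
(`lieDeriv_bracket_of_top`). [cite: Bump1997, §2.2 ((2.24), Prop. 2.2.5)] -/
theorem raiseFun_lowerFun {φ : G → ℂ} (hφ : IsArchSmooth ι φ) :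
    raiseFun ι (lowerFun ι φ) =
      (2 : ℂ) • casimirFun ι φ + lieDeriv ι (toLie rotGen) (lieDeriv ι (toLie rotGen) φ) -
        (2 * Complex.I) • lieDeriv ι (toLie rotGen) φ := by
  -- smoothness of the first derivatives
  have hh := isArchSmooth_lieDeriv_toLie hφ hMat
  have he := isArchSmooth_lieDeriv_toLie hφ e₁₂
  have hf := isArchSmooth_lieDeriv_toLie hφ e₂₁
  have hef := he.add ι hf
  have hIef := hef.smul ι Complex.I
  -- the two bracket relations
  have hb1 : lieDeriv ι (toLie hMat) (lieDeriv ι (toLie e₁₂) φ) - lieDeriv ι (toLie e₁₂) (lieDeriv ι (toLie hMat) φ) =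
      (2 : ℝ) • lieDeriv ι (toLie e₁₂) φ := by
    rw [← lieDeriv_bracket_of_top ι gl2_lie_eq_top gl2_carrier_eq_top (toLie hMat) (toLie e₁₂) hφ, lie_hMat_e₁₂,
      hφ.lieDeriv_smul_left ι]
  have hb2 : lieDeriv ι (toLie hMat) (lieDeriv ι (toLie e₂₁) φ) - lieDeriv ι (toLie e₂₁) (lieDeriv ι (toLie hMat) φ) =
      (-2 : ℝ) • lieDeriv ι (toLie e₂₁) φ := by
    rw [← lieDeriv_bracket_of_top ι gl2_lie_eq_top gl2_carrier_eq_top (toLie hMat) (toLie e₂₁) hφ, lie_hMat_e₂₁,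
      hφ.lieDeriv_smul_left ι]
  -- expand everything by linearity
  have hW := lieDeriv_rotGen_eq_sub hφ
  have hD : IsArchSmooth ι (lieDeriv ι (toLie e₁₂) φ - lieDeriv ι (toLie e₂₁) φ) := by
    have h := he.add ι (hf.smul ι (-1))
    simpa [sub_eq_add_neg] using h
  have hWW : lieDeriv ι (toLie rotGen) (lieDeriv ι (toLie rotGen) φ) =
      lieDeriv ι (toLie e₁₂) (lieDeriv ι (toLie e₁₂) φ) - lieDeriv ι (toLie e₁₂) (lieDeriv ι (toLie e₂₁) φ) -
        (lieDeriv ι (toLie e₂₁) (lieDeriv ι (toLie e₁₂) φ) - lieDeriv ι (toLie e₂₁) (lieDeriv ι (toLie e₂₁) φ)) := by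
    rw [hW, lieDeriv_rotGen_eq_sub hD, lieDeriv_sub_of_isArchSmooth _ he hf, lieDeriv_sub_of_isArchSmooth _ he hf]
  unfold raiseFun lowerFun casimirFun
  rw [lieDeriv_sub_of_isArchSmooth _ hh hIef, lieDeriv_sub_of_isArchSmooth _ hh hIef, lieDeriv_sub_of_isArchSmooth _ hh hIef,
    lieDeriv_smul, lieDeriv_smul, lieDeriv_smul, IsArchSmooth.lieDeriv_add ι _ he hf, IsArchSmooth.lieDeriv_add ι _ he hf,
    IsArchSmooth.lieDeriv_add ι _ he hf, hWW, hW]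
  funext x
  have e1 := congrFun hb1 x
  have e2 := congrFun hb2 x
  simp only [Pi.sub_apply, Pi.smul_apply, Pi.add_apply, smul_eq_mul, Complex.real_smul] at e1 e2 ⊢
  push_cast at e1 e2 ⊢
  linear_combination Complex.I * e1 * (-1) + Complex.I * e2 * (-1) -
    (lieDeriv ι (toLie e₁₂) (lieDeriv ι (toLie e₁₂) φ) x + lieDeriv ι (toLie e₁₂) (lieDeriv ι (toLie e₂₁) φ) x +
      lieDeriv ι (toLie e₂₁) (lieDeriv ι (toLie e₁₂) φ) x + lieDeriv ι (toLie e₂₁) (lieDeriv ι (toLie e₂₁) φ) x) *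
        Complex.I_sq

/-- **`X̄ X` on a weight vector which is a `Ω`-eigenfunction**: if `φ` is archimedean-smooth of
weight `m` and `Ω φ = c φ`, then `X̄ (X φ) = (2c - m² + 2m) φ` (`W φ = im φ`). For `c = -1/2` this is
`-(m - 1)² φ`: **`X̄ X` kills exactly the weight-one vectors** (Bump 1997, Exercise 2.1.7 (b); Gelbart
1997, Remark 2.5.5: "`X·φ_k = ((s₁ - s₂ + 1)/2 - k/2) φ_k`"). [cite: Bump1997, Exercise 2.1.7]
[cite: Gelbart1997, Remark 2.5.5] -/
theorem raiseFun_lowerFun_of_isWeightVec {m : ℤ} {φ : G → ℂ} (hφ : IsArchSmooth ι φ)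
    (hw : IsWeightVec ι m φ) {c : ℂ} (hc : casimirFun ι φ = c • φ) :
    raiseFun ι (lowerFun ι φ) = (2 * c - m ^ 2 + 2 * m) • φ := by
  rw [raiseFun_lowerFun hφ, hc, hw.lieDeriv_rotGen, lieDeriv_smul, hw.lieDeriv_rotGen, smul_smul, smul_smul]
  funext x
  simp only [Pi.add_apply, Pi.sub_apply, Pi.smul_apply, smul_eq_mul]
  linear_combination ((m : ℂ) ^ 2 * φ x - 2 * (m : ℂ) * φ x) * Complex.I_sq

end Operators

/-! ### Extraction of a weight-one vector killed by the lowering operator -/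

section Extraction

variable {G : Type*} [Group G] {ι : (RealMatrixGroup.gl ℝ (Fin 2)).carrier →* G}

/-- **From an odd `K`-type to a weight-one vector killed by `X`.** Let `W₁` be a space of
archimedean-smooth functions on `G` stable under the Lie derivatives along `GL₂(ℝ)` and under
`r(ε)`, on which the Casimir operator `Ω` acts by `-1/2` (the infinitesimal character of `π(1, sgn)`,
Harish-Chandra parameter `{0, 0}`). If `W₁` contains a non-zero vector of *odd* weight, then it
contains a non-zero vector of weight `1` killed by the lowering operator. Proof (Gelbart 1997,
Remark 2.5.5; Bump 1997, Exercise 2.1.7): replacing `v` by `r(ε) v` we may take the weight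
`m = 2j + 1` positive; `X̄ X = -(m-1)²` on weight `m` (`raiseFun_lowerFun_of_isWeightVec`), so
`X v, X² v, …, X^j v` are non-zero of weights `m - 2, …, 1`; on the weight-one vector `u = X^j v`,
`X̄ (X u) = 0`, so either `X u = 0`, or `w = X u ≠ 0` has weight `-1` with `X̄ w = 0` and then
`r(ε) w` has weight `1` and `X (r(ε) w) = r(ε) (X̄ w) = 0`. [cite: Gelbart1997, Remark 2.5.5]
[cite: Bump1997, Exercise 2.1.7] -/
theorem exists_isWeightVec_one_lowerFun_eq_zero {W₁ : Submodule ℂ (G → ℂ)}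
    (hsmooth : ∀ φ ∈ W₁, IsArchSmooth ι φ)
    (heps : ∀ φ ∈ W₁, archTranslate ι epsK φ ∈ W₁)
    (hlie : ∀ (X : Matrix (Fin 2) (Fin 2) ℝ), ∀ φ ∈ W₁, lieDeriv ι (toLie X) φ ∈ W₁)
    (hcas : ∀ φ ∈ W₁, casimirFun ι φ = (-(1 / 2 : ℂ)) • φ)
    {m : ℤ} (hm : Odd m) {v : G → ℂ} (hvW : v ∈ W₁) (hv0 : v ≠ 0) (hv : IsWeightVec ι m v) :
    ∃ ψ ∈ W₁, ψ ≠ 0 ∧ IsWeightVec ι 1 ψ ∧ lowerFun ι ψ = 0 := by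
  -- membership of `X φ`, `X̄ φ` in `W₁`
  have hlow : ∀ φ ∈ W₁, lowerFun ι φ ∈ W₁ := fun φ hφ =>
    W₁.sub_mem (hlie _ φ hφ) (W₁.smul_mem _ (W₁.add_mem (hlie _ φ hφ) (hlie _ φ hφ)))
  -- `r(ε)` is injective
  have heps0 : ∀ φ : G → ℂ, archTranslate ι epsK φ = 0 → φ = 0 := fun φ h => by
    have h2 : archTranslate ι epsK (archTranslate ι epsK φ) = φ := by
      rw [← Module.End.mul_apply, ← map_mul, epsK_mul_epsK, map_one, Module.End.one_apply]
    rw [← h2, h, map_zero]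
  -- the positive odd case, by induction on `j`, `m = 2j + 1`
  have pos : ∀ (j : ℕ) (u : G → ℂ), u ∈ W₁ → u ≠ 0 → IsWeightVec ι (2 * (j : ℤ) + 1) u →
      ∃ ψ ∈ W₁, ψ ≠ 0 ∧ IsWeightVec ι 1 ψ ∧ lowerFun ι ψ = 0 := by
    intro j
    induction j with
    | zero =>
      intro u huW hu0 hu
      simp only [Nat.cast_zero, mul_zero, zero_add] at hu
      by_cases hL : lowerFun ι u = 0
      · exact ⟨u, huW, hu0, hu, hL⟩
      · -- `w = X u ≠ 0` has weight `-1` and `X̄ w = 0`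
        have hwW := hlow u huW
        have hww : IsWeightVec ι (-1) (lowerFun ι u) := by
          have h := hu.weight_lowerFun (hsmooth u huW); norm_num at h; exact h
        have hRw : raiseFun ι (lowerFun ι u) = 0 := by
          rw [raiseFun_lowerFun_of_isWeightVec (hsmooth u huW) hu (hcas u huW)]
          norm_num
        refine ⟨archTranslate ι epsK (lowerFun ι u), heps _ hwW, fun h => hL (heps0 _ h), ?_, ?_⟩
        · have h := hww.archTranslate_epsK; simpa using h
        · rw [← archTranslate_epsK_raiseFun (hsmooth _ (heps _ hwW)), hRw, map_zero]
    | succ j ih =>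
      intro u huW hu0 hu
      have hwW := hlow u huW
      have hww : IsWeightVec ι (2 * (j : ℤ) + 1) (lowerFun ι u) := by
        have h := hu.weight_lowerFun (hsmooth u huW)
        push_cast at h ⊢
        convert h using 2
        ring
      have hw0 : lowerFun ι u ≠ 0 := by
        intro h0
        have hRL := raiseFun_lowerFun_of_isWeightVec (hsmooth u huW) hu (hcas u huW)
        rw [h0, raiseFun_zero] at hRL
        rcases smul_eq_zero.1 hRL.symm with hc0 | hu00
        · push_cast at hc0
          have h' : (2 * (j : ℂ) + 2) ^ 2 = 0 := by linear_combination -hc0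
          have hne : (2 * (j : ℂ) + 2) ≠ 0 := by exact_mod_cast (show (2 * j + 2 : ℕ) ≠ 0 by omega)
          exact (pow_ne_zero 2 hne) h'
        · exact hu0 hu00
      exact ih (lowerFun ι u) hwW hw0 hww
  -- reduce to the positive case
  obtain ⟨k, rfl⟩ := hm
  rcases le_or_gt 0 k with hk | hk
  · lift k to ℕ using hk
    exact pos k v hvW hv0 hv
  · -- negative weight: apply `r(ε)`
    have hv' := hv.archTranslate_epsK
    have hk' : -(2 * k + 1) = 2 * (-k - 1) + 1 := by ring
    rw [hk'] at hv'
    have hnn : 0 ≤ -k - 1 := by omega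
    obtain ⟨j, hj⟩ : ∃ j : ℕ, (j : ℤ) = -k - 1 := ⟨(-k - 1).toNat, Int.toNat_of_nonneg hnn⟩
    rw [← hj] at hv'
    exact pos j _ (heps v hvW) (fun h => hv0 (heps0 v h)) hv'

end Extraction

/-! ### Assembly: from a `K`-finite vector of odd sign to a weight-one vector killed by `X` -/

section Assembly

variable {G : Type*} [Group G] {ι : (RealMatrixGroup.gl ℝ (Fin 2)).carrier →* G}

/-- **A non-zero `SO(2)`-finite vector on which `-1` acts by `-1`, in a stable space where
`Ω = -1/2`, yields a non-zero weight-one vector killed by the lowering operator.** Hypotheses on the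
space `W₁` of functions on `G`: archimedean smoothness, stability under the Lie derivatives along
`GL₂(ℝ)` and under `r(ε)`, `Ω = -1/2` on `W₁` (Harish-Chandra parameter `{0, 0}`), and `k_π = -1`
acts by `-1` (the sign of `π(1, sgn)`; Gelbart 1997, proof of Prop. 4.2); on the vector `φ ≠ 0`:
it lies in a finite-dimensional rotation-stable subspace of `W₁` (`K_∞`-finiteness). Conclusion:
`W₁` contains `ψ ≠ 0` of weight `1` with `X ψ = 0` — the vector-level form of "`π_∞ = π(1, sgn)`",
Gelbart 1997, Remark 2.5.2 and Remark 2.5.5 ("we must have `s₁ = s₂ = 0`, i.e., `π_∞ = π(1,sgn)`",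
read backwards: parameter `{0,0}` and odd sign give a weight-one vector with `X · φ = 0`).
[cite: Gelbart1997, Remark 2.5.5] [cite: Bump1997, Exercise 2.1.7] -/
theorem exists_isWeightVec_one_lowerFun_eq_zero_of_finite {W₁ : Submodule ℂ (G → ℂ)}
    (hsmooth : ∀ φ ∈ W₁, IsArchSmooth ι φ)
    (heps : ∀ φ ∈ W₁, archTranslate ι epsK φ ∈ W₁)
    (hlie : ∀ (X : Matrix (Fin 2) (Fin 2) ℝ), ∀ φ ∈ W₁, lieDeriv ι (toLie X) φ ∈ W₁)
    (hcas : ∀ φ ∈ W₁, casimirFun ι φ = (-(1 / 2 : ℂ)) • φ)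
    (hneg : ∀ φ ∈ W₁, ∀ g, φ (g * ι (rotK Real.pi)) = -φ g)
    {φ : G → ℂ} (hφ0 : φ ≠ 0)
    (hfin : ∃ V : Submodule ℂ (G → ℂ), FiniteDimensional ℂ V ∧ φ ∈ V ∧ V ≤ W₁ ∧
      ∀ θ : ℝ, ∀ ψ ∈ V, archTranslate ι (rotK θ) ψ ∈ V) :
    ∃ ψ ∈ W₁, ψ ≠ 0 ∧ IsWeightVec ι 1 ψ ∧ lowerFun ι ψ = 0 := by
  obtain ⟨V, hVfd, hφV, hVW, hVrot⟩ := hfin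
  haveI := hVfd
  have hV : V ≠ ⊥ := fun h => hφ0 (by rw [h] at hφV; exact (Submodule.mem_bot ℂ).1 hφV)
  obtain ⟨m, v, hvV, hv0, hv⟩ :=
    exists_isWeightVec_mem_of_finiteDimensional hV hVrot fun ψ hψ => hsmooth ψ (hVW hψ)
  have hodd : Odd m := hv.odd (hneg v (hVW hvV)) hv0
  exact exists_isWeightVec_one_lowerFun_eq_zero hsmooth heps hlie hcas hodd (hVW hvV) hv0 hv

end Assembly

/-! ### Reading weight and lowering operator on `GL₂(ℝ)` through a homomorphism `GL₂(ℝ) → G` -/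

section Restriction

variable {G : Type*} [Group G] (j : GL (Fin 2) ℝ →* G)

/-- The homomorphism `GL₂(ℝ) → G` restricted to (the carrier `⊤` of) the linear real group. [folklore] -/
abbrev inclOf : (RealMatrixGroup.gl ℝ (Fin 2)).carrier →* G :=
  j.comp (RealMatrixGroup.gl ℝ (Fin 2)).carrier.subtype

variable {j}

/-- Lie derivatives along `j` at points `a · j(x)` are Lie derivatives on `GL₂(ℝ)` of the pulled back
function `x ↦ ψ(a · j(x))`. [folklore] -/
theorem lieDeriv_inclOf_apply (ψ : G → ℂ) (a : G) (X : Matrix (Fin 2) (Fin 2) ℝ) (x : GL (Fin 2) ℝ) :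
    lieDeriv (inclOf j) (toLie X) ψ (a * j x) = lieDeriv incl (toLie X) (fun y => ψ (a * j y)) x := by
  unfold lieDeriv
  congr 1
  funext t
  change ψ (a * j x * j (expGL (t • X))) = ψ (a * j (x * expGL (t • X)))
  rw [map_mul, mul_assoc]

/-- The lowering operator along `j` at `a · j(x)` is the lowering operator on `GL₂(ℝ)` of the pull-back.
[cite: Gelbart1997, (2.5.4) (v)] -/
theorem lowerFun_inclOf_apply (ψ : G → ℂ) (a : G) (x : GL (Fin 2) ℝ) :
    lowerFun (inclOf j) ψ (a * j x) = lowering (fun y => ψ (a * j y)) x := by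
  simp only [lowerFun, lowering, Pi.sub_apply, Pi.smul_apply, Pi.add_apply, smul_eq_mul, lieDeriv_inclOf_apply,
    hMat]

/-- **`X ψ = 0` along `j` gives `X · F = 0` on `GL₂(ℝ)` for every pull-back `F = ψ(a · j(·))`.**
[cite: Gelbart1997, (2.5.4) (v)] -/
theorem lowering_eq_zero_of_lowerFun_eq_zero {ψ : G → ℂ} (h : lowerFun (inclOf j) ψ = 0) (a : G)
    (x : GL (Fin 2) ℝ) : lowering (fun y => ψ (a * j y)) x = 0 := by
  rw [← lowerFun_inclOf_apply, h, Pi.zero_apply]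

/-- Archimedean smoothness along `j` gives archimedean smoothness on `GL₂(ℝ)` of every pull-back. [folklore] -/
theorem isArchSmooth_incl_of_inclOf {ψ : G → ℂ} (h : IsArchSmooth (inclOf j) ψ) (a : G) :
    IsArchSmooth incl (fun y => ψ (a * j y)) := by
  intro x
  have h1 := h (a * j x)
  have e : (fun X : (RealMatrixGroup.gl ℝ (Fin 2)).lie.toSubmodule =>
      (fun y => ψ (a * j y)) (x * incl ((RealMatrixGroup.gl ℝ (Fin 2)).expMem ⟨(X : Matrix (Fin 2) (Fin 2) ℝ), X.2⟩))) =
      fun X : (RealMatrixGroup.gl ℝ (Fin 2)).lie.toSubmodule =>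
        ψ (a * j x * inclOf j ((RealMatrixGroup.gl ℝ (Fin 2)).expMem ⟨(X : Matrix (Fin 2) (Fin 2) ℝ), X.2⟩)) := by
    funext X
    change ψ (a * j (x * expGL (X : Matrix (Fin 2) (Fin 2) ℝ))) = ψ (a * j x * j (expGL (X : Matrix (Fin 2) (Fin 2) ℝ)))
    rw [map_mul, mul_assoc]
  rw [e]
  exact h1

/-- **`Z ψ = 0` integrates to invariance under the positive scalars**: if `ψ` is archimedean-smooth
along `j` and killed by `Z = 1 ∈ 𝔤𝔩₂(ℝ)`, then `ψ(g · j(r · 1)) = ψ(g)` for `r > 0`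
(`d/dt ψ(g j(e^t)) = (Z ψ)(g j(e^t)) = 0`). Gelbart 1997, (2.5.4) (iv). [cite: Gelbart1997, (2.5.4) (iv)] -/
theorem apply_mul_realScalarGL_of_lieDeriv_one {ψ : G → ℂ} (hs : IsArchSmooth (inclOf j) ψ)
    (hZ : lieDeriv (inclOf j) (toLie 1) ψ = 0) (g : G) {r : ℝ} (hr : 0 < r) :
    ψ (g * j (realScalarGL r hr)) = ψ g := by
  set F : ℝ → ℂ := fun t => ψ (g * inclOf j ((RealMatrixGroup.gl ℝ (Fin 2)).expMem (t • toLie 1))) with hF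
  have hFd : ∀ s : ℝ, HasDerivAt F 0 s := by
    intro s
    have h := hs.hasDerivAt_flow (inclOf j) (toLie 1) g s
    rw [hZ] at h
    simpa only [hF, Pi.zero_apply] using h
  have hconst : ∀ t : ℝ, F t = F 0 := by
    have hdiff : Differentiable ℝ F := fun s => (hFd s).differentiableAt
    exact fun t => is_const_of_deriv_eq_zero hdiff (fun s => (hFd s).deriv) t 0
  have h1 := hconst (Real.log r)
  simp only [hF, zero_smul, expMem_zero_gl2, map_one, mul_one] at h1
  have h2 : inclOf j ((RealMatrixGroup.gl ℝ (Fin 2)).expMem (Real.log r • toLie 1)) = j (realScalarGL r hr) := by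
    change j (expGL (Real.log r • (1 : Matrix (Fin 2) (Fin 2) ℝ))) = _
    rw [expGL_smul_one]
    congr 1
    refine Units.ext ?_
    rw [coe_realScalarGL, coe_realScalarGL, Real.exp_log hr]
  rw [h2] at h1
  exact h1

/-- **Weight one and `Z ψ = 0` give Gelbart's conditions (iii)–(iv) with `k = 1`** for every
pull-back: if `ψ` has `SO(2)`-weight `1` along `j`, is archimedean-smooth and killed by `Z`, then
`F = ψ(a · j(·))` has weight `1` at the archimedean place (`HasArchWeight 1 F`:
`F(g r(θ)) = e^{-iθ} F(g)`, `F(g · r) = F(g)`). [cite: Gelbart1997, (2.5.4) (iii)–(iv)] -/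
theorem hasArchWeight_one_of_isWeightVec {ψ : G → ℂ} (hw : IsWeightVec (inclOf j) 1 ψ)
    (hs : IsArchSmooth (inclOf j) ψ) (hZ : lieDeriv (inclOf j) (toLie 1) ψ = 0) (a : G) :
    HasArchWeight 1 fun y => ψ (a * j y) := by
  refine hasArchWeight_of_rotGL_of_realScalarGL (fun g θ _ => ?_) (fun g r hr _ => ?_)
  · have h := hw (-θ) (a * j g)
    have hk : inclOf j (rotK (-θ)) = j (rotGL θ) := by
      change j (rotGL (-(-θ))) = _; rw [neg_neg]
    rw [hk, mul_assoc, ← map_mul] at h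
    change ψ (a * j (g * rotGL θ)) = ψ (a * j g) * _
    rw [h, ← Complex.exp_int_mul]
    push_cast
    ring_nf
  · rw [map_mul, ← mul_assoc]
    exact apply_mul_realScalarGL_of_lieDeriv_one hs hZ _ hr

end Restriction

end GL2Real

end Literature.NumberTheory.Automorphic

end
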